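import Summits.NavierStokesRegularity.NavierStokesRegularity.Theorems.ArgmaxNearDoorsDefs
import Summits.NavierStokesRegularity.NavierStokesRegularity.Theorems.ArgmaxNearDoorsBudget
import HarnessLib

/-!
# ArgmaxNearDoorsPlates — door family S36 §A «ArgmaxNearDoors»: plates N♭ and N♭β BY NAME

S-door lane (ns-sfl-p1 g5; LEAD ns-s30-p1 g3; texts of record nsreg-p1 g30 ROUND-34 `r34/Sketch36.lean` sha16
f0fe6d26e287c4b8 = tree P0 `Theorems/ArgmaxNearDoorsDefs.lean` p651846; `--supports stmt-NavierStokesRegularity-0056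
--as helper`). The two dissipation budgets of §A against P0's Prop names, by `exact` from
`Theorems/ArgmaxNearDoorsBudget.lean` (p651529), whose statements are the δ-unfolded texts:

* `slabDissipationBudget_holds : SlabDissipationBudget` (N♭);
* `shrinkingDissipationBudget_holds : ShrinkingDissipationBudget` (N♭β).

With `localDepletion_holds` (D♭, P0 part 3) and the LEAD's `nearEngine_holds` / `nearEngineWeighted_holds` (E♭/E♭w)
these close doors S36-C♭/C♯ via `argmaxNearCoherenceDoor_of_engine` / `argmaxShrinkingCoherenceDoor_of_engine`.

WHAT THIS IS NOT: regularity CRITERIA plates about hypothetical blow-up; item 0056 `NoTypeII` and NS regularity are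
NOT proved; nothing here is a route or a summit statement.
-/

-- the summit's problem namespace repeats the summit name (tree layout)
set_option linter.dupNamespace false

noncomputable section

namespace Summit.NavierStokesRegularity.NavierStokesRegularity.Theorems.ArgmaxDoors

/-- plate N♭ «SlabDissipationBudget» of door family S36 BY NAME (P0 `ArgmaxNearDoorsDefs`): on every end slab of the
frame, `∫_{t₁}^{t} ‖ω(s)‖_{L²} ds ≤ √(t − t₁)·√(C‖u(0)‖²₂/ν)` with a universal `C`. -/
theorem slabDissipationBudget_holds : SlabDissipationBudget :=
  slabDissipationBudget

/-- plate N♭β «ShrinkingDissipationBudget» of door family S36 BY NAME (P0 `ArgmaxNearDoorsDefs`): the dissipation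
budget against the shrinking-ball weight `(4π/(3(r₀(T−s)^β)³))^{1/2}`, `0 < β < 1/3`. -/
theorem shrinkingDissipationBudget_holds : ShrinkingDissipationBudget :=
  shrinkingDissipationBudget

end Summit.NavierStokesRegularity.NavierStokesRegularity.Theorems.ArgmaxDoors

end
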